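import Summits.ValiantsHypothesis.ValiantsHypothesis.Theses.IntegralOrbits
import Literature.Computability.AlgebraicComplexity.TauConjectureDischarge
import Summits.ValiantsHypothesis.ValiantsHypothesis.Theorems.IntegralOrbitsTauBurgisserDetStubTauDetCF
import Summits.ValiantsHypothesis.ValiantsHypothesis.Theorems.IntegralOrbitsTauBurgisserDetStubPerBitsQP
import Summits.ValiantsHypothesis.ValiantsHypothesis.Theorems.IntegralOrbitsTauBurgisserDetStubChCollapseQP
import Summits.ValiantsHypothesis.ValiantsHypothesis.Theorems.IntegralOrbitsTauBurgisserDetStubTauEndgame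
import Summits.ValiantsHypothesis.ValiantsHypothesis.Theorems.IntegralOrbitsTauBurgisserDetStubTransferWitness
import Summits.ValiantsHypothesis.ValiantsHypothesis.Theorems.IntegralOrbitsTauBurgisserDetStubTransferCore
import Summits.ValiantsHypothesis.ValiantsHypothesis.Theorems.IntegralOrbitsTauBurgisserDetStubTransferQP

/-!
# Birth skeleton — crux `TauBurgisserDet` (item `stmt-ValiantsHypothesis-7680`), line `birth`

Route `route-ValiantsHypothesis-IntegralOrbits` (rank-4 crux), decl
`Summit.ValiantsHypothesis.ValiantsHypothesis.Theses.IntegralOrbits.TauBurgisserDet`: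

  τ-conjecture (Shub–Smale; = the route item `TauConjecture`, verbatim) →
  ¬ SignDetQP,   SignDetQP := ∃ c n₀, ∀ n ≥ n₀, ∃ m ≤ 2^((log₂ n + c)^c), d ≥ 1, N ≠ 0 and an m × m matrix A of
  affine forms over ℤ in the n² variables, all coefficients in {−1,0,1}, with det A = N · per_n^d

("Bürgisser 2009 Thm 1.1(2)/Main Thm 1.2 re-run at quasi-polynomial granularity, with powers d and an integer
multiplier N"). THE LINE is the printed proof of Bürgisser's transfer theorem — which the tree has DISCHARGED at
polynomial/circuit granularity (`Literature/…/TauConjectureDischarge.lean`: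
`not_isPBounded_constantFreeComplexity_perPoly_of_tauConjecture_holds`, assembled from Lemma 2.12
`PP_subset_PPoly_of_isPBounded_perPoly_holds`, Lemma 2.5(2) `CH_subset_PPoly_of_PP_subset_PPoly_holds`,
Thm 4.1(2) `Burgisser2009_thm41_2_uniform_holds` (Thm 2.10 + the Koiran step Thm 2.11 inside), Cor. 3.9
`Burgisser2009_pochhammerWilkinson_coeff_chDefinable_holds` and the root count
`not_isPBounded_constantFreeComplexity_perPoly_of_tauConjecture_of`) — transported step by step to the crux's
granularity. Quasi-polynomial replaces polynomial (qp ∘ qp = qp), the hypothesis "τ(PER_n) = n^{O(1)}" is replaced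
by the sign-determinantal expressions `det A = N · per_n^d` of SignDetQP, and the two places where the printed proof
touches the permanent are re-run for `N · per^d`:  Boolean side — `per(x) = ((det A(x))/N)^{1/d}` exactly on 0/1
matrices (`per(x) ≥ 0`), so the 0/1 permanent, hence `PP`, gets quasi-polynomial-size circuits;  algebraic side —
the `VNP⁰`-type interpolating family `G` of the Koiran step satisfies `2^p · G = PER_P(2y)` (constant-free
completeness, Thm 2.10), hence `N · (2^p · G)^d = (det A_P)(2y)` is constant-free computable in size poly(m_P), and
ring-hom substitution carries the power `d` and the multiplier `N` down to `N · (2^e · f_n)^d`, which keeps the `n`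
distinct integer roots `1, …, n` of the Pochhammer–Wilkinson polynomial `f_n = ∏_{k ≤ n} (X − k)`.

Registered stubs (each the qp/(d,N)-analogue of a NAMED in-tree theorem; none is the crux or the summit reworded —
BC3 probes `stub → TauBurgisserDet`, `stub → ValiantsHypothesis` by `first | exact? | simpa | aesop` all fail).
LEAD RESHAPE (2026-08-17, cycle 1): a fifth stub `stub_tauDetCF` — `τ(DET_m) = m^{O(1)}` for the tree's
CONSTANT-FREE measure (the tree has `complexity_detPoly_le` for `complexity` only) — is registered and its
statement is passed by the composition to `stub_perBitsQP` and `stub_transferQP` as an explicit first hypothesis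
(both evaluate `det A = N · per^d` by a constant-free circuit); nothing else changed.

* `stub_tauDetCF`       — `IsPBounded (m ↦ τ(detPoly (Fin m) ℤ))` (Berkowitz, constants `0, ±1`).      [size M]

* `stub_perBitsQP`      — Lemma 2.12_qp:  SignDetQP → PP ⊆ qpSIZE := ⋃_c SIZE(2^((log₂ n + c)^c)).   [size L]
* `stub_chCollapseQP`   — Lemma 2.5(2)_qp: PP ⊆ qpSIZE → CH ⊆ qpSIZE (induction on the levels `CₖP`, circuit
                           evaluation in `P`, hard-wired quasi-polynomial advice; qp ∘ qp = qp).            [size M]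
* `stub_transferQP`     — Thm 4.1(2)_qp with powers and multiplier: SignDetQP → CH ⊆ qpSIZE → for every coefficient
                           sequence `(b(n,k))_{k ≤ q(n)}` definable in `CH` (Bürgisser Def. 3.1, tree `IsCHDefinable`)
                           there are `c, n₁` such that for every `n ≥ n₁` some `N ≠ 0, e, d ≥ 1` have
                           τ(N · (2^e · Σ_{k ≤ q(n)} b(n,k) X^k)^d) ≤ 2^((log₂ log₂ n + c)^c)  ("quasi-polynomial in
                           log n"; the Koiran step Thm 2.11 for qpSIZE predicates with SIGNED coefficients — no
                           `b = b⁺ − b⁻` split, which powers forbid — and Thm 2.10 for qp-size Boolean sums).  [size XL;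
                           the hardest stub, = the item's own "why it might fail"]
* `stub_tauEndgame`     — Thm 1.1(2)_qp endgame: the τ-conjecture and such a bound for the Pochhammer–Wilkinson
                           polynomials are contradictory: `N · (2^e f_n)^d ≠ 0` has ≥ n distinct integer roots, so
                           n ≤ (2^((log₂ log₂ n + c)^c) + 2)^{c₀} for all n ≥ n₁, false at n = 2^(2^k), k large.  [size M]

`TauBurgisserDet_of : stub₁-sig → stub₂-sig → stub₃-sig → stub₄-sig → TauBurgisserDet` is the REAL composition
(sorry-free, standard axioms): it feeds the tree's Cor. 3.9 (`Burgisser2009_pochhammerWilkinson_coeff_chDefinable_holds`)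
to `stub_transferQP` and rewrites `Σ_k coeff_k(f_n) X^k = f_n` (`sum_range_coeff_pochhammerWilkinson`). Its
hypotheses are the stub statements under the name-keyed aliases `Registered.stub_*` (device of
`Cruxes/RestorationQP/Lines/birth.lean`: `#h21_check_skeleton` admits hypotheses that are registered obligations /
declared stubs BY NAME); the closing `example : TauBurgisserDet` wires the four sorried stubs into it, certifying
that aliases and stub signatures agree. `sorry` occurs ONLY in the four `stub_*` theorems.

Disproof used: none — `ledger crux ls stmt-ValiantsHypothesis-7680` showed no workfiles (no `Disproof.lean`, no
`_false_without_` theorem, no landed `Theorems/TauBurgisserDet/Negative/*`) at registration (2026-08-17).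
Negatives index (`ledger negatives --problem ValiantsHypothesis`): nothing on τ / counting-hierarchy / sign
determinants bears on these stubs. Both hypotheses of the crux are load-bearing in the line: the τ-conjecture is used
(only) in `stub_tauEndgame`, SignDetQP in `stub_perBitsQP` (Boolean side) and `stub_transferQP` (algebraic side).
Barrier `Literature.Barriers.ValiantsHypothesis.TauRealZeros` concerns the τ-conjecture itself (real zeros), not this
transfer; `PermanentCharTwo` is not touched (no reduction mod 2 anywhere: integers are recovered exactly / 2-adically
to full precision as in the tree's Lemma 2.12 proof).
-/

set_option linter.dupNamespace false

namespace Summit.ValiantsHypothesis.ValiantsHypothesis.Cruxes.TauBurgisserDet.Birth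

open Summit.ValiantsHypothesis.ValiantsHypothesis.Theses.IntegralOrbits (TauBurgisserDet TauConjecture)

/-! ## The four registered stubs -/

/-- **Stub 0 — the generic determinant has polynomial-size CONSTANT-FREE circuits**
(`τ(DET_m) = m^{O(1)}`, `τ = constantFreeComplexity`, `DET_m = detPoly (Fin m) ℤ = det (X_{ij})`).
Proof route: Berkowitz 1984 / Samuelson — the coefficient vector of the characteristic polynomial is an
iterated product of Toeplitz matrices with entries `0, ±1, -X_{tt}, -R M^q S`, no divisions and NO constants
other than `0, ±1`; the tree proves exactly this circuit for Bürgisser's `complexity`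
(`DetInVP.lean`: `detPoly_eq_toepProd`, `aeval_detSubst_immPoly`, `berkNum_eq_aeval`,
`complexity_detPoly_le : L(DET_n) ≤ 8 (n+1)^7` via `complexity_immPoly_le`, `complexity_aeval_le`), and every
cost lemma used there has a constant-free twin (`constantFreeComplexity_aeval_le`, `constantFreeComplexity_mul_le`,
`constantFreeComplexity_add_le/_sub_le/_neg`, `constantFreeComplexity_C_neg_one`, sums) in
`ConstantFreeCircuits.lean`; port the IMM bound (`exists_immPoly_succ_succ` + substitution) and the Berkowitz
assembly to `constantFreeComplexity`. Needed by stubs 1 and 3 (every use of `det A = N · per^d` evaluates a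
determinant by a constant-free circuit). Why plausibly true: standard (Berkowitz is constant-free). Size: M.
[cite: Berkowitz1984] [cite: Burgisser2000, Prop. 2.30] -/
theorem stub_tauDetCF :
    Literature.Computability.AlgebraicComplexity.IsPBounded fun m =>
      Literature.Computability.AlgebraicComplexity.constantFreeComplexity
        (Literature.Computability.AlgebraicComplexity.detPoly (Fin m) ℤ) :=
  Summit.ValiantsHypothesis.ValiantsHypothesis.Theorems.IntegralOrbitsTauBurgisserDet.stub_tauDetCF

/-- **Stub 1 — Lemma 2.12 at quasi-polynomial granularity, sign-determinant form (Boolean side).**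
If for all large `n` some `N · per_n^d` (`N ≠ 0`, `d ≥ 1`) is the determinant of a matrix of affine forms with
coefficients in `{−1,0,1}` and quasi-polynomial size `m ≤ 2^((log₂ n + c)^c)` (SignDetQP, the statement the crux
denies), then `PP` has quasi-polynomial-size circuits: `PP ⊆ ⋃_c SIZE(2^((log₂ n + c)^c))`.
Proof route (Bürgisser 2009, Lemma 2.12, re-run): on a 0/1 matrix `x`, `det A(x) = N · per(x)^d` is an integer
determinant of an `m × m` integer matrix with entries `≤ n² + 1`, computable by `B₂`-circuits of size poly(m · log n)
(division-free determinant, e.g. Berkowitz, on poly(m log n)-bit integers; cf. the tree's `cktSize_permCount`,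
`cktSize_testBits_aeval_eval`); exact division by the hard-wired `N` and the exact integer `d`-th root (`per(x) ≥ 0`)
are poly(bit-length) circuits; the 0/1 permanent is `#P`-hard (Valiant 1979; tree fact
`Valiant1979_per01Plain_isSharpPHardFun`, or the tree's fact-free route of `SharpPBitsPPoly.lean` through the
`VNP⁰`-completeness of `PER`, with `N · (2^p f)^d` in place of `2^p f`), so every `PP` language gets circuits of size
poly(ℓ) · qp(poly ℓ) = qp(ℓ). Dimensions `< n₀` never occur for long inputs (or are hard-wired).
Why plausibly true: standard; every ingredient exists at polynomial granularity in the tree. Size: L.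
[cite: Burgisser2009, Lemma 2.12] [cite: Valiant1979, Thm. 1] -/
theorem stub_perBitsQP :
    (Literature.Computability.AlgebraicComplexity.IsPBounded fun m =>
        Literature.Computability.AlgebraicComplexity.constantFreeComplexity
          (Literature.Computability.AlgebraicComplexity.detPoly (Fin m) ℤ)) →
    (∃ c n₀ : ℕ, ∀ n ≥ n₀, ∃ (m d : ℕ) (N : ℤ)
        (A : Matrix (Fin m) (Fin m) (MvPolynomial (Fin n × Fin n) ℤ)),
        1 ≤ d ∧ m ≤ 2 ^ ((Nat.log 2 n + c) ^ c) ∧ N ≠ 0 ∧ (∀ i j, (A i j).totalDegree ≤ 1) ∧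
          (∀ i j s, |MvPolynomial.coeff s (A i j)| ≤ 1) ∧
          A.det = MvPolynomial.C N * Literature.Computability.AlgebraicComplexity.perPoly (Fin n) ℤ ^ d) →
      Literature.Computability.Complexity.PP ⊆
        ⋃ c : ℕ, Literature.Computability.Complexity.SIZE (fun n => 2 ^ ((Nat.log 2 n + c) ^ c)) :=
  Summit.ValiantsHypothesis.ValiantsHypothesis.Theorems.IntegralOrbitsTauBurgisserDet.stub_perBitsQP

/-- **Stub 2 — Lemma 2.5(2) at quasi-polynomial granularity (collapse of the counting hierarchy).**
`PP ⊆ qpSIZE ⇒ CH ⊆ qpSIZE`, `qpSIZE := ⋃_c SIZE(2^((log₂ n + c)^c))`.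
Proof route (Bürgisser 2009, Lemma 2.5; tree `CH_subset_PPoly_of_PP_subset_PPoly_holds` re-run): induction on the
levels `CₖP`; for `L ∈ C'·CₖP` with witness `B ∈ CₖP ⊆ qpSIZE`, the language
`L' = {⟨x, ⌜C⌝⟩ | a majority of y has C(⟨x, y⟩) = 1}` is in `PP` (circuit evaluation is in `P`, tree
`PPoly_subset_polyAdvice_P`), hence in `SIZE(qp)` at input length `|x| + qp(|x|)`; hard-wiring the description of
the circuit `C` for `B` gives `L ∈ SIZE(qp(|x| + qp(|x|))) = SIZE(qp(|x|))` (qp ∘ qp = qp — the one point the item's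
"why it might fail" asks to re-check, and it is fine).
Why plausibly true: standard padding/advice argument. Size: M. [cite: Burgisser2009, Lemma 2.5] -/
theorem stub_chCollapseQP :
    (Literature.Computability.Complexity.PP ⊆
        ⋃ c : ℕ, Literature.Computability.Complexity.SIZE (fun n => 2 ^ ((Nat.log 2 n + c) ^ c))) →
      Literature.Computability.Complexity.CH ⊆
        ⋃ c : ℕ, Literature.Computability.Complexity.SIZE (fun n => 2 ^ ((Nat.log 2 n + c) ^ c)) :=
  Summit.ValiantsHypothesis.ValiantsHypothesis.Theorems.IntegralOrbitsTauBurgisserDet.stub_chCollapseQP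

/-- **Stub 3 — Theorem 4.1(2) at quasi-polynomial granularity, with powers and an integer multiplier
(algebraic side; THE HARDEST STUB).** Under SignDetQP and the collapse `CH ⊆ qpSIZE`: for every coefficient
sequence `(b(n,k))_{k ≤ q(n)}` definable in `CH` (Bürgisser Def. 3.1; tree `IsCHDefinable q b`: `q` p-bounded,
polynomial bitsize, sign and bit languages in `CH`) there are constants `c, n₁` such that for every `n ≥ n₁` some
`N ≠ 0`, `e`, `d ≥ 1` satisfy `τ(N · (2^e · Σ_{k ≤ q(n)} b(n,k) X^k)^d) ≤ 2^((log₂ log₂ n + c)^c)`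
(`τ = tauPoly = constantFreeComplexity` on `ℤ[X]`; "quasi-polynomial in `log n`").
Proof route (Bürgisser 2009, proof of Thm 4.1(2), pp. 14–15, re-run; tree `Burgisser2009_thm41_2_of_steps`,
`thm41_2_signPart_PPoly` as templates): the SIGNED two-block interpolating polynomial
`B_n(Y,Z) = Σ_{j ≤ p(n)} Σ_{k ≤ q(n)} sgn(b(n,k)) · bit_j|b(n,k)| · Y^{bits j} Z^{bits k}` has its coefficient
predicate in `CH ⊆ qpSIZE`, i.e. circuits of size `s = 2^(polylog log n)` on the `O(log n)`-bit queries; Koiran's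
criterion (Thm 2.11, tree `Burgisser2009_thm41_koiranStep_holds`) re-run for qpSIZE predicates and signed values
makes `B_n` a substitution instance of ONE family `G_r = Σ_{u ∈ {0,1}^{O(s)}} H_r(·, u)` with `H_r` constant-free of
size and formal degree `O(s)` (do NOT split `b = b⁺ − b⁻`: powers do not pass through differences); constant-free
completeness of `PER` (Thm 2.10 = Koiran 2004 Thm 4.3, tree `Burgisser2009_thm210_holds`, re-run at size qp:
parse-tree formula of size poly(s), then Valiant's projection) gives `2^p · G_r = PER_P(2y)`, `P = poly(s)`;
SignDetQP at dimension `P` (≥ n₀ for n large) gives `N · (2^p · G_r)^d = (det A_P)(2y)`, constant-free computable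
in size poly(m_P) · P² with `m_P ≤ 2^((log₂ P + c)^c) = 2^(polylog log n)`; the substitutions `blockSubst` and
`Y_i ↦ 2^{2^i}`, `Z_i ↦ X^{2^i}` (tree `aeval_twoBlockPoly_powers`, cost `O(log² n)`) are ring homs, so they carry
`N · (2^p · _)^d` to `N · (2^p · f_n)^d`, `f_n = Σ_k b(n,k) X^k`.
Why it might fail: only if one of Thm 2.10 / Thm 2.11 is genuinely polynomial-only when re-run for qp-size
`VNP⁰`-type families (unverified in print — the item's own risk); all bookkeeping is qp ∘ qp ∘ poly = qp. Size: XL.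
[cite: Burgisser2009, Thm. 4.1(2), Thm. 2.10, Thm. 2.11] [cite: Koiran2004, Thm. 4.3, Thm. 6.1]

FINAL (cycle 2, 2026-08-17): ALL SEVEN STUBS LANDED (tauDetCF p148052, perBitsQP p147583, chCollapseQP p147482,
tauEndgame p147167, transferWitness p150240, transferCore p150276, transferQP p149411); the crux is CLOSED as proved by
`Summit.ValiantsHypothesis.ValiantsHypothesis.Theorems.tauBurgisserDet_proof` (Theorems/IntegralOrbitsTauBurgisserDet.lean,
p150642). This workfile is now sorry-free: every `stub_*` below is the landed theorem.

LEAD RESHAPE (cycle 2): split into 3a `stub_transferWitness` (signed Koiran witness, explicit), 3b `stub_transferCore`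
(explicit Thm 2.10 + SignDetQP + det cost), 3c `stub_transferQP` (assembly + qp bookkeeping, takes 3a and 3b as hypotheses).

**Stub 3a — the SIGNED two-block Koiran witness at explicit granularity** (Bürgisser Thm 2.11 = Koiran 2004 Thm 6.1,
re-run): for digit counts `ℓ = bitLen (p n)`, `μ = bitLen (q n)`, a block size `M` and two `B₂`-circuit families
`CF⁺, CF⁻` of size `≤ M` at all query lengths `≤ 8(ℓ+μ)+9`, ONE fan-in-two sign-constant circuit `P` over
`KoiranVars ℓ μ ⊕ Fin (ℓ+μ+M+1)` of size `≤ 160(ℓ+μ+M+1)^5 + 6` and formal degree `≤ 6(ℓ+μ+M) + 15` whose Boolean sum,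
under `blockSubst p q n`, is the DIFFERENCE of the two-block polynomials of the arrays decided by `CF⁺` and `CF⁻`.
Proof route: `gS := X t · gK π⁺ − (1 − X t) · gK π⁻` over the common Boolean block `BV ⊕ Unit` (`π± = ⟨ℓ, μ, M, CF±, …⟩`,
tree `KoiranW.gK`, `hasTauDeg_gK`, `gKSize_le`, `gKDeg_le`, `HasTauDeg.mul/one_sub/sub/rename`); `bsum gS = bsum gK⁺ − bsum gK⁻`
(split the sum over the selector bit); `aeval_bsubN_bsum_gK` + range restriction as in `KData.aeval_blockSubst_G`;
`DefVNP.boolSum_rename_equiv` to enumerate the block by `Fin (ℓ+μ+M+1)`. Size: M. [cite: Burgisser2009, Thm. 2.11]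
[cite: Koiran2004, Thm. 6.1] -/
theorem stub_transferWitness :
    ∀ (p q : ℕ → ℕ) (n M : ℕ) (CFp CFm : Literature.Computability.Complexity.CircuitFamily),
      n ≤ p n →
      (∀ m, (CFp m).IsOver Literature.Computability.Complexity.B2) → (∀ m, (CFm m).IsOver Literature.Computability.Complexity.B2) →
      (∀ m, m ≤ 8 * (Literature.Computability.AlgebraicComplexity.bitLen (p n) + Literature.Computability.AlgebraicComplexity.bitLen (q n)) + 9 → (CFp m).size ≤ M) →
      (∀ m, m ≤ 8 * (Literature.Computability.AlgebraicComplexity.bitLen (p n) + Literature.Computability.AlgebraicComplexity.bitLen (q n)) + 9 → (CFm m).size ≤ M) →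
      ∃ P : Literature.Computability.AlgebraicComplexity.ArithCircuit ℤ
          (Literature.Computability.AlgebraicComplexity.KoiranVars (Literature.Computability.AlgebraicComplexity.bitLen (p n)) (Literature.Computability.AlgebraicComplexity.bitLen (q n)) ⊕
            Fin (Literature.Computability.AlgebraicComplexity.bitLen (p n) + Literature.Computability.AlgebraicComplexity.bitLen (q n) + M + 1)),
        P.IsFanInTwo ∧ P.HasSignConstants ∧
        P.size ≤ 160 * (Literature.Computability.AlgebraicComplexity.bitLen (p n) + Literature.Computability.AlgebraicComplexity.bitLen (q n) + M + 1) ^ 5 + 6 ∧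
        P.formalDegree ≤ 6 * (Literature.Computability.AlgebraicComplexity.bitLen (p n) + Literature.Computability.AlgebraicComplexity.bitLen (q n) + M) + 15 ∧
        MvPolynomial.aeval (Literature.Computability.AlgebraicComplexity.blockSubst p q n) (Literature.Computability.AlgebraicComplexity.boolSum P.eval) =
          Literature.Computability.AlgebraicComplexity.twoBlockPoly p q
              (fun n' k j => (CFp (Literature.Computability.AlgebraicComplexity.encBitQuery n' k j true).length).eval
                (Literature.Computability.AlgebraicComplexity.encBitQuery n' k j true).get) n -
            Literature.Computability.AlgebraicComplexity.twoBlockPoly p q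
              (fun n' k j => (CFm (Literature.Computability.AlgebraicComplexity.encBitQuery n' k j true).length).eval
                (Literature.Computability.AlgebraicComplexity.encBitQuery n' k j true).get) n :=
  Summit.ValiantsHypothesis.ValiantsHypothesis.Theorems.IntegralOrbitsTauBurgisserDet.stub_transferWitness

/-- **Stub 3b — the explicit algebraic core: Thm 2.10 at explicit size + SignDetQP at the padded dimension +
the constant-free determinant.** For ANY fan-in-two sign-constant circuit `P(X, e)` over `σ ⊕ Fin u` of size `≤ S`
and formal degree `≤ D`, and any substitution `g`, if `τ(DET_m) ≤ m^cd + cd` and sign-determinantal expressions of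
`N · per_pd^d` of size `≤ 2^((log pd + cA)^cA)` exist for all `pd ≥ n₀`, then for `Pd := max n₀ (cfBound S D u + S + 2)`
some `N ≠ 0, e (= Pd), d ≥ 1` have `τ(N · (2^e · (Σ_e P)(g))^d) ≤ mb^cd + cd + mb² (Pd³ + 4 Pd² + 1) + Σ_v τ(g v)`,
`mb := 2^((log Pd + cA)^cA)`. Proof route: `ArithCircuit.exists_permanent_boolSum` + `exists_perProjection_matrix`
(per B' = 2^Pd Σ_e P, B' a Pd × Pd matrix of entries `2 X_v` / cheap constants), SignDetQP at `Pd ≥ n₀`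
(`det A = N per_Pd^d`), substitute the entries of `B'` (`aeval_entries_perPoly`, `AlgHom.map_det`):
`det (A.map φ) = N (2^Pd Σ_e P)^d`; cost `τ(det (A.map φ)) ≤ τ(DET_mA) + Σ_ij τ(φ (A i j))`
(`constantFreeComplexity_det_le`, `constantFreeComplexity_le_of_affine_unit`, `IsPerProjectionEntry.constantFreeComplexity_le`,
`constantFreeComplexity_aeval_le`), then `aeval g` (`constantFreeComplexity_aeval_le`). Size: M.
[cite: Burgisser2009, Thm. 2.10] [cite: Koiran2004, Thm. 4.3] -/
theorem stub_transferCore :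
    ∀ (σ τ : Type) [Fintype σ] (u S D cd n₀ cA : ℕ)
      (P : Literature.Computability.AlgebraicComplexity.ArithCircuit ℤ (σ ⊕ Fin u)) (g : σ → MvPolynomial τ ℤ),
      P.IsFanInTwo → P.HasSignConstants → P.size ≤ S → P.formalDegree ≤ D →
      (∀ m, Literature.Computability.AlgebraicComplexity.constantFreeComplexity (Literature.Computability.AlgebraicComplexity.detPoly (Fin m) ℤ) ≤ m ^ cd + cd) →
      (∀ pd ≥ n₀, ∃ (m d : ℕ) (N : ℤ) (A : Matrix (Fin m) (Fin m) (MvPolynomial (Fin pd × Fin pd) ℤ)),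
          1 ≤ d ∧ m ≤ 2 ^ ((Nat.log 2 pd + cA) ^ cA) ∧ N ≠ 0 ∧ (∀ i j, (A i j).totalDegree ≤ 1) ∧
            (∀ i j s, |MvPolynomial.coeff s (A i j)| ≤ 1) ∧
            A.det = MvPolynomial.C N * Literature.Computability.AlgebraicComplexity.perPoly (Fin pd) ℤ ^ d) →
      ∃ (N : ℤ) (e d : ℕ), N ≠ 0 ∧ 1 ≤ d ∧
        Literature.Computability.AlgebraicComplexity.constantFreeComplexity
            (MvPolynomial.C N * (MvPolynomial.C ((2 : ℤ) ^ e) * MvPolynomial.aeval g (Literature.Computability.AlgebraicComplexity.boolSum P.eval)) ^ d) ≤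
          (2 ^ ((Nat.log 2 (max n₀ (Literature.Computability.AlgebraicComplexity.ArithCircuit.cfBound S D u + S + 2)) + cA) ^ cA)) ^ cd + cd +
            (2 ^ ((Nat.log 2 (max n₀ (Literature.Computability.AlgebraicComplexity.ArithCircuit.cfBound S D u + S + 2)) + cA) ^ cA)) ^ 2 *
              ((max n₀ (Literature.Computability.AlgebraicComplexity.ArithCircuit.cfBound S D u + S + 2)) ^ 3 +
                4 * (max n₀ (Literature.Computability.AlgebraicComplexity.ArithCircuit.cfBound S D u + S + 2)) ^ 2 + 1) +
            ∑ v, Literature.Computability.AlgebraicComplexity.constantFreeComplexity (g v) :=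
  Summit.ValiantsHypothesis.ValiantsHypothesis.Theorems.IntegralOrbitsTauBurgisserDet.stub_transferCore

open Literature.Computability.AlgebraicComplexity Literature.Computability.Complexity in
/-- **Stub 3c — Theorem 4.1(2) at quasi-polynomial granularity, with powers and an integer multiplier
(assembly + qp bookkeeping)**, from the signed witness (3a) and the explicit core (3b): for `b` definable in `CH`
take `L± := Bit(|b|) ∩ {sgn}^± ∈ CH ⊆ qpSIZE` (`inter_mem_CH`, `CH_closed_fst`, `compl_mem_CH`), circuits `CF±` of
size `≤ 2^((log m + c±)^c±)`, `p n := n^c_b + n`, `M n := 2^((log (8 r + 9) + c')^c')`, `r = bitLen (p n) + bitLen (q n)`;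
3a gives the circuit, 3b (with `g := powers ∘ blockSubst`, cost `ℓ² + μ²`: `constantFreeComplexity_blockSubst`,
`sum_constantFreeComplexity_powers_le`) gives `N, e, d` and the bound; `aeval powers (B⁺ − B⁻) = Σ_k b(n,k) X^k`
(`aeval_twoBlockPoly_powers`, `sum_bits_posPart/negPart`, n ≥ 2); everything is qp in `r = O(log n)`
(`IsQPBounded.*`, `two_pow_qexp_log`, `qp_comp`, `polylog_bitLen`), i.e. `≤ 2^((log log n + c)^c)`. Size: L.
[cite: Burgisser2009, Thm. 4.1(2)] -/
theorem stub_transferQP :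
    (∀ (p q : ℕ → ℕ) (n M : ℕ) (CFp CFm : CircuitFamily),
      n ≤ p n →
      (∀ m, (CFp m).IsOver B2) → (∀ m, (CFm m).IsOver B2) →
      (∀ m, m ≤ 8 * (bitLen (p n) + bitLen (q n)) + 9 → (CFp m).size ≤ M) →
      (∀ m, m ≤ 8 * (bitLen (p n) + bitLen (q n)) + 9 → (CFm m).size ≤ M) →
      ∃ P : ArithCircuit ℤ
          (KoiranVars (bitLen (p n)) (bitLen (q n)) ⊕
            Fin (bitLen (p n) + bitLen (q n) + M + 1)),
        P.IsFanInTwo ∧ P.HasSignConstants ∧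
        P.size ≤ 160 * (bitLen (p n) + bitLen (q n) + M + 1) ^ 5 + 6 ∧
        P.formalDegree ≤ 6 * (bitLen (p n) + bitLen (q n) + M) + 15 ∧
        MvPolynomial.aeval (blockSubst p q n) (boolSum P.eval) =
          twoBlockPoly p q
              (fun n' k j => (CFp (encBitQuery n' k j true).length).eval
                (encBitQuery n' k j true).get) n -
            twoBlockPoly p q
              (fun n' k j => (CFm (encBitQuery n' k j true).length).eval
                (encBitQuery n' k j true).get) n) →
    (∀ (σ τ : Type) [Fintype σ] (u S D cd n₀ cA : ℕ)
      (P : ArithCircuit ℤ (σ ⊕ Fin u)) (g : σ → MvPolynomial τ ℤ),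
      P.IsFanInTwo → P.HasSignConstants → P.size ≤ S → P.formalDegree ≤ D →
      (∀ m, constantFreeComplexity (detPoly (Fin m) ℤ) ≤ m ^ cd + cd) →
      (∀ pd ≥ n₀, ∃ (m d : ℕ) (N : ℤ) (A : Matrix (Fin m) (Fin m) (MvPolynomial (Fin pd × Fin pd) ℤ)),
          1 ≤ d ∧ m ≤ 2 ^ ((Nat.log 2 pd + cA) ^ cA) ∧ N ≠ 0 ∧ (∀ i j, (A i j).totalDegree ≤ 1) ∧
            (∀ i j s, |MvPolynomial.coeff s (A i j)| ≤ 1) ∧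
            A.det = MvPolynomial.C N * perPoly (Fin pd) ℤ ^ d) →
      ∃ (N : ℤ) (e d : ℕ), N ≠ 0 ∧ 1 ≤ d ∧
        constantFreeComplexity
            (MvPolynomial.C N * (MvPolynomial.C ((2 : ℤ) ^ e) * MvPolynomial.aeval g (boolSum P.eval)) ^ d) ≤
          (2 ^ ((Nat.log 2 (max n₀ (ArithCircuit.cfBound S D u + S + 2)) + cA) ^ cA)) ^ cd + cd +
            (2 ^ ((Nat.log 2 (max n₀ (ArithCircuit.cfBound S D u + S + 2)) + cA) ^ cA)) ^ 2 *
              ((max n₀ (ArithCircuit.cfBound S D u + S + 2)) ^ 3 +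
                4 * (max n₀ (ArithCircuit.cfBound S D u + S + 2)) ^ 2 + 1) +
            ∑ v, constantFreeComplexity (g v)) →
    (IsPBounded fun m =>
        constantFreeComplexity
          (detPoly (Fin m) ℤ)) →
    (∃ c n₀ : ℕ, ∀ n ≥ n₀, ∃ (m d : ℕ) (N : ℤ)
        (A : Matrix (Fin m) (Fin m) (MvPolynomial (Fin n × Fin n) ℤ)),
        1 ≤ d ∧ m ≤ 2 ^ ((Nat.log 2 n + c) ^ c) ∧ N ≠ 0 ∧ (∀ i j, (A i j).totalDegree ≤ 1) ∧
          (∀ i j s, |MvPolynomial.coeff s (A i j)| ≤ 1) ∧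
          A.det = MvPolynomial.C N * perPoly (Fin n) ℤ ^ d) →
      (CH ⊆
        ⋃ c : ℕ, SIZE (fun n => 2 ^ ((Nat.log 2 n + c) ^ c))) →
      ∀ (q : ℕ → ℕ) (b : ℕ → ℕ → ℤ), IsCHDefinable q b →
        ∃ c n₁ : ℕ, ∀ n ≥ n₁, ∃ (N : ℤ) (e d : ℕ), N ≠ 0 ∧ 1 ≤ d ∧
          tauPoly
              (Polynomial.C N * (Polynomial.C ((2 : ℤ) ^ e) *
                ∑ k ∈ Finset.range (q n + 1), Polynomial.C (b n k) * Polynomial.X ^ k) ^ d) ≤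
            2 ^ ((Nat.log 2 (Nat.log 2 n) + c) ^ c) :=
  Summit.ValiantsHypothesis.ValiantsHypothesis.Theorems.IntegralOrbitsTauBurgisserDet.stub_transferQP

/-- **Stub 4 — the τ-endgame at quasi-polylogarithmic cost (Thm 1.1(2), last five lines, re-run).**
The Shub–Smale τ-conjecture (the route item `TauConjecture`, by name) is incompatible with a bound
`τ(N · (2^e · f_n)^d) ≤ 2^((log₂ log₂ n + c)^c)` (`N ≠ 0`, `d ≥ 1`) holding for all large `n` for the
Pochhammer–Wilkinson polynomials `f_n = ∏_{k=1}^{n} (X − k)` (tree `pochhammerWilkinson`): `g_n = N · (2^e f_n)^d ≠ 0`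
is divisible by `f_n`, so it has at least the `n` distinct integer roots `1, …, n`
(`card_roots_toFinset_pochhammerWilkinson`, `Polynomial.roots.le_of_dvd`), and the τ-conjecture gives
`n ≤ (τ(g_n) + 2)^{c₀} ≤ (2^((log₂ log₂ n + c)^c) + 2)^{c₀}` for all `n ≥ n₁` — false at `n = 2^(2^k)` for `k` large
(`c₀((k + c)^c + 2) < 2^k` eventually; cf. the tree's `exists_pow_log_lt` one exponential lower).
Why plausibly true: elementary; it is the template `not_isPBounded_constantFreeComplexity_perPoly_of_tauConjecture_of`
with `(N, d)` and one more logarithm. Size: M. [cite: Burgisser2009, proof of Thm. 1.1(2)] [cite: ShubSmale1995, §1] -/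
theorem stub_tauEndgame :
    TauConjecture →
      (∃ c n₁ : ℕ, ∀ n ≥ n₁, ∃ (N : ℤ) (e d : ℕ), N ≠ 0 ∧ 1 ≤ d ∧
          Literature.Computability.AlgebraicComplexity.tauPoly
              (Polynomial.C N * (Polynomial.C ((2 : ℤ) ^ e) *
                Literature.Computability.AlgebraicComplexity.pochhammerWilkinson n) ^ d) ≤
            2 ^ ((Nat.log 2 (Nat.log 2 n) + c) ^ c)) →
      False :=
  Summit.ValiantsHypothesis.ValiantsHypothesis.Theorems.IntegralOrbitsTauBurgisserDet.stub_tauEndgame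

/-! ## Name-keyed aliases of the four stub statements (hypotheses of the composition)

`Registered.stub_X : Prop` is the statement of `stub_X` verbatim, under the stub's short name, so that the native
skeleton audit (`#h21_check_skeleton`: hypotheses admissible iff registered obligations / declared stubs BY NAME)
accepts `TauBurgisserDet_of : Registered.stub_… → … → TauBurgisserDet` (device of
`Cruxes/RestorationQP/Lines/birth.lean`, `PneNP/Cruxes/WindowBarrier/Lines/entropy-support-dichotomy.lean`). -/
namespace Registered

/-- Alias: the signature of `stub_tauDetCF`. -/
abbrev stub_tauDetCF : Prop :=
    Literature.Computability.AlgebraicComplexity.IsPBounded fun m =>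
      Literature.Computability.AlgebraicComplexity.constantFreeComplexity
        (Literature.Computability.AlgebraicComplexity.detPoly (Fin m) ℤ)

/-- Alias: the signature of `stub_perBitsQP`. -/
abbrev stub_perBitsQP : Prop :=
    (Literature.Computability.AlgebraicComplexity.IsPBounded fun m =>
        Literature.Computability.AlgebraicComplexity.constantFreeComplexity
          (Literature.Computability.AlgebraicComplexity.detPoly (Fin m) ℤ)) →
    (∃ c n₀ : ℕ, ∀ n ≥ n₀, ∃ (m d : ℕ) (N : ℤ)
        (A : Matrix (Fin m) (Fin m) (MvPolynomial (Fin n × Fin n) ℤ)),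
        1 ≤ d ∧ m ≤ 2 ^ ((Nat.log 2 n + c) ^ c) ∧ N ≠ 0 ∧ (∀ i j, (A i j).totalDegree ≤ 1) ∧
          (∀ i j s, |MvPolynomial.coeff s (A i j)| ≤ 1) ∧
          A.det = MvPolynomial.C N * Literature.Computability.AlgebraicComplexity.perPoly (Fin n) ℤ ^ d) →
      Literature.Computability.Complexity.PP ⊆
        ⋃ c : ℕ, Literature.Computability.Complexity.SIZE (fun n => 2 ^ ((Nat.log 2 n + c) ^ c))

/-- Alias: the signature of `stub_chCollapseQP`. -/
abbrev stub_chCollapseQP : Prop :=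
    (Literature.Computability.Complexity.PP ⊆
        ⋃ c : ℕ, Literature.Computability.Complexity.SIZE (fun n => 2 ^ ((Nat.log 2 n + c) ^ c))) →
      Literature.Computability.Complexity.CH ⊆
        ⋃ c : ℕ, Literature.Computability.Complexity.SIZE (fun n => 2 ^ ((Nat.log 2 n + c) ^ c))

/-- Alias: the signature of `stub_transferWitness`. -/
abbrev stub_transferWitness : Prop :=
    ∀ (p q : ℕ → ℕ) (n M : ℕ) (CFp CFm : Literature.Computability.Complexity.CircuitFamily),
      n ≤ p n →
      (∀ m, (CFp m).IsOver Literature.Computability.Complexity.B2) → (∀ m, (CFm m).IsOver Literature.Computability.Complexity.B2) →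
      (∀ m, m ≤ 8 * (Literature.Computability.AlgebraicComplexity.bitLen (p n) + Literature.Computability.AlgebraicComplexity.bitLen (q n)) + 9 → (CFp m).size ≤ M) →
      (∀ m, m ≤ 8 * (Literature.Computability.AlgebraicComplexity.bitLen (p n) + Literature.Computability.AlgebraicComplexity.bitLen (q n)) + 9 → (CFm m).size ≤ M) →
      ∃ P : Literature.Computability.AlgebraicComplexity.ArithCircuit ℤ
          (Literature.Computability.AlgebraicComplexity.KoiranVars (Literature.Computability.AlgebraicComplexity.bitLen (p n)) (Literature.Computability.AlgebraicComplexity.bitLen (q n)) ⊕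
            Fin (Literature.Computability.AlgebraicComplexity.bitLen (p n) + Literature.Computability.AlgebraicComplexity.bitLen (q n) + M + 1)),
        P.IsFanInTwo ∧ P.HasSignConstants ∧
        P.size ≤ 160 * (Literature.Computability.AlgebraicComplexity.bitLen (p n) + Literature.Computability.AlgebraicComplexity.bitLen (q n) + M + 1) ^ 5 + 6 ∧
        P.formalDegree ≤ 6 * (Literature.Computability.AlgebraicComplexity.bitLen (p n) + Literature.Computability.AlgebraicComplexity.bitLen (q n) + M) + 15 ∧
        MvPolynomial.aeval (Literature.Computability.AlgebraicComplexity.blockSubst p q n) (Literature.Computability.AlgebraicComplexity.boolSum P.eval) =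
          Literature.Computability.AlgebraicComplexity.twoBlockPoly p q
              (fun n' k j => (CFp (Literature.Computability.AlgebraicComplexity.encBitQuery n' k j true).length).eval
                (Literature.Computability.AlgebraicComplexity.encBitQuery n' k j true).get) n -
            Literature.Computability.AlgebraicComplexity.twoBlockPoly p q
              (fun n' k j => (CFm (Literature.Computability.AlgebraicComplexity.encBitQuery n' k j true).length).eval
                (Literature.Computability.AlgebraicComplexity.encBitQuery n' k j true).get) n

/-- Alias: the signature of `stub_transferCore`. -/
abbrev stub_transferCore : Prop :=
    ∀ (σ τ : Type) [Fintype σ] (u S D cd n₀ cA : ℕ)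
      (P : Literature.Computability.AlgebraicComplexity.ArithCircuit ℤ (σ ⊕ Fin u)) (g : σ → MvPolynomial τ ℤ),
      P.IsFanInTwo → P.HasSignConstants → P.size ≤ S → P.formalDegree ≤ D →
      (∀ m, Literature.Computability.AlgebraicComplexity.constantFreeComplexity (Literature.Computability.AlgebraicComplexity.detPoly (Fin m) ℤ) ≤ m ^ cd + cd) →
      (∀ pd ≥ n₀, ∃ (m d : ℕ) (N : ℤ) (A : Matrix (Fin m) (Fin m) (MvPolynomial (Fin pd × Fin pd) ℤ)),
          1 ≤ d ∧ m ≤ 2 ^ ((Nat.log 2 pd + cA) ^ cA) ∧ N ≠ 0 ∧ (∀ i j, (A i j).totalDegree ≤ 1) ∧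
            (∀ i j s, |MvPolynomial.coeff s (A i j)| ≤ 1) ∧
            A.det = MvPolynomial.C N * Literature.Computability.AlgebraicComplexity.perPoly (Fin pd) ℤ ^ d) →
      ∃ (N : ℤ) (e d : ℕ), N ≠ 0 ∧ 1 ≤ d ∧
        Literature.Computability.AlgebraicComplexity.constantFreeComplexity
            (MvPolynomial.C N * (MvPolynomial.C ((2 : ℤ) ^ e) * MvPolynomial.aeval g (Literature.Computability.AlgebraicComplexity.boolSum P.eval)) ^ d) ≤
          (2 ^ ((Nat.log 2 (max n₀ (Literature.Computability.AlgebraicComplexity.ArithCircuit.cfBound S D u + S + 2)) + cA) ^ cA)) ^ cd + cd +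
            (2 ^ ((Nat.log 2 (max n₀ (Literature.Computability.AlgebraicComplexity.ArithCircuit.cfBound S D u + S + 2)) + cA) ^ cA)) ^ 2 *
              ((max n₀ (Literature.Computability.AlgebraicComplexity.ArithCircuit.cfBound S D u + S + 2)) ^ 3 +
                4 * (max n₀ (Literature.Computability.AlgebraicComplexity.ArithCircuit.cfBound S D u + S + 2)) ^ 2 + 1) +
            ∑ v, Literature.Computability.AlgebraicComplexity.constantFreeComplexity (g v)

/-- Alias: the signature of `stub_transferQP` (its first two hypotheses are the statements of
`stub_transferWitness` and `stub_transferCore`, verbatim = the two aliases above). -/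
abbrev stub_transferQP : Prop :=
    stub_transferWitness → stub_transferCore →
    (Literature.Computability.AlgebraicComplexity.IsPBounded fun m =>
        Literature.Computability.AlgebraicComplexity.constantFreeComplexity
          (Literature.Computability.AlgebraicComplexity.detPoly (Fin m) ℤ)) →
    (∃ c n₀ : ℕ, ∀ n ≥ n₀, ∃ (m d : ℕ) (N : ℤ)
        (A : Matrix (Fin m) (Fin m) (MvPolynomial (Fin n × Fin n) ℤ)),
        1 ≤ d ∧ m ≤ 2 ^ ((Nat.log 2 n + c) ^ c) ∧ N ≠ 0 ∧ (∀ i j, (A i j).totalDegree ≤ 1) ∧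
          (∀ i j s, |MvPolynomial.coeff s (A i j)| ≤ 1) ∧
          A.det = MvPolynomial.C N * Literature.Computability.AlgebraicComplexity.perPoly (Fin n) ℤ ^ d) →
      (Literature.Computability.Complexity.CH ⊆
        ⋃ c : ℕ, Literature.Computability.Complexity.SIZE (fun n => 2 ^ ((Nat.log 2 n + c) ^ c))) →
      ∀ (q : ℕ → ℕ) (b : ℕ → ℕ → ℤ), Literature.Computability.AlgebraicComplexity.IsCHDefinable q b →
        ∃ c n₁ : ℕ, ∀ n ≥ n₁, ∃ (N : ℤ) (e d : ℕ), N ≠ 0 ∧ 1 ≤ d ∧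
          Literature.Computability.AlgebraicComplexity.tauPoly
              (Polynomial.C N * (Polynomial.C ((2 : ℤ) ^ e) *
                ∑ k ∈ Finset.range (q n + 1), Polynomial.C (b n k) * Polynomial.X ^ k) ^ d) ≤
            2 ^ ((Nat.log 2 (Nat.log 2 n) + c) ^ c)

/-- Alias: the signature of `stub_tauEndgame`. -/
abbrev stub_tauEndgame : Prop :=
    TauConjecture →
      (∃ c n₁ : ℕ, ∀ n ≥ n₁, ∃ (N : ℤ) (e d : ℕ), N ≠ 0 ∧ 1 ≤ d ∧
          Literature.Computability.AlgebraicComplexity.tauPoly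
              (Polynomial.C N * (Polynomial.C ((2 : ℤ) ^ e) *
                Literature.Computability.AlgebraicComplexity.pochhammerWilkinson n) ^ d) ≤
            2 ^ ((Nat.log 2 (Nat.log 2 n) + c) ^ c)) →
      False

end Registered

/-! ## The composition (kernel-checked, sorry-free) -/

/-- **Skeleton theorem — the crux BY NAME from the four stubs** (Bürgisser 2009, proof of Thm 1.1(2), p. 15, at
quasi-polynomial granularity): assume the τ-conjecture and SignDetQP; the Boolean side (stubs 1–2) collapses `CH` to
quasi-polynomial size; the algebraic side (stub 3), applied to the `CH`-definable coefficient sequence of the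
Pochhammer–Wilkinson polynomials — Bürgisser's Cor. 3.9, a THEOREM of the tree
(`Burgisser2009_pochhammerWilkinson_coeff_chDefinable_holds`) — bounds `τ(N · (2^e · f_n)^d)` quasi-polynomially
in `log n` (`Σ_k coeff_k(f_n) X^k = f_n`, `sum_range_coeff_pochhammerWilkinson`); the endgame (stub 4) derives the
contradiction. [cite: Burgisser2009, proof of Thm. 1.1(2)] -/
theorem TauBurgisserDet_of :
    Registered.stub_transferWitness → Registered.stub_transferCore → Registered.stub_transferQP →
      TauBurgisserDet := by
  intro hW hCore h41 hτ hS
  -- the four LANDED stubs (cycle 1): constant-free determinant, Boolean side, collapse, endgame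
  have hdet : Registered.stub_tauDetCF := stub_tauDetCF
  have h212 : Registered.stub_perBitsQP := stub_perBitsQP
  have h25 : Registered.stub_chCollapseQP := stub_chCollapseQP
  have hend : Registered.stub_tauEndgame := stub_tauEndgame
  -- Boolean side: `CH ⊆ qpSIZE`
  have hCH := h25 (h212 hdet hS)
  -- algebraic side at the Pochhammer–Wilkinson coefficients (Cor. 3.9, in tree)
  obtain ⟨c, n₁, hc⟩ := h41 hW hCore hdet hS hCH (fun n => n)
    (fun n k => (Literature.Computability.AlgebraicComplexity.pochhammerWilkinson n).coeff k)
    Literature.Computability.AlgebraicComplexity.Burgisser2009_pochhammerWilkinson_coeff_chDefinable_holds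
  -- endgame
  refine hend hτ ⟨c, n₁, fun n hn => ?_⟩
  obtain ⟨N, e, d, hN, hd, hb⟩ := hc n hn
  refine ⟨N, e, d, hN, hd, ?_⟩
  simpa only [Literature.Computability.AlgebraicComplexity.sum_range_coeff_pochhammerWilkinson] using hb

/-- Wiring check: the four registered stubs feed `TauBurgisserDet_of` exactly as stated (aliases = signatures), so
the skeleton is `TauBurgisserDet` closed modulo the stubs; sorries enter only through them. -/
example : TauBurgisserDet :=
  TauBurgisserDet_of stub_transferWitness stub_transferCore stub_transferQP

end Summit.ValiantsHypothesis.ValiantsHypothesis.Cruxes.TauBurgisserDet.Birth
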